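import Summits.Ventures.YMGap.YM3IR.ForestWitness
import Summits.Ventures.YMGap.YM3IR.InMean
import Summits.Ventures.YMGap.YM3IR.CovariantFamily
import HarnessLib

/-!
# YM3IR / InMeanWitness — the free-family infrared hypotheses form ONE equivalence class with the target (kernel)

HONEST FRAMING.  Bookkeeping for the cell's track-Y4 honest label (lead R196), NOT mathematics about Yang–Mills: no
mass gap is proved, no continuum statement is made, nothing is claimed about Bałaban's programme.  The §Y4 sentence of
record `massGap3Cofinal_su2_balaban_of_irConjecture3` (`YM3IR/BalabanSU2.lean`) carries ONE conjecture-labelled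
hypothesis; the tree types that hypothesis in FOUR free-family currencies — almost-sure `IRConjecture3`, in-mean
`IRConjecture3InMean` (`YM3IR/InMean.lean`: «the quotable conjecture in its weakest used form»), and the statement-of-record hypotheses
`T_IR` / `T_IRInMean` whose clause (a) is guarded by `BalabanUV3 mk` (`Crossover3`).  `YM3IR/ForestWitness.lean`
certified `(∃ C_b κ > 0, IRConjecture3 …) ↔ MassGap3Cofinal I …` on the §Y4 ball.  THIS FILE closes the class: with
their two bookkeeping constants existential, ALL FOUR free-family forms are kernel-EQUIVALENT to `MassGap3Cofinal` on
every ball carrying the forest witness and Y2's clustering — the in-mean forms outright, the `T_IR` forms given print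
(`BalabanUV3 mk`, which only un-guards clause (a)).  READ IT CORRECTLY: weakening the fluctuation clauses to `L¹`
(the large-field-friendly currency) or guarding clause (a) by Bałaban's theorems changes the HYPOTHESES of the one
conjecture, not its logical status AS TYPED OVER A FREE MEASURABLE BLOCK FAMILY; «weaker»/«weakest» in `InMean.lean` is true
clause-wise and remains the reason the in-mean form is the right one to quote, but it is NOT «strictly weaker than the
target».  What DOES change the status is PINNING the family: theory-1's `IRConjecture3Cov` (gauge-covariant, block-local
family, `YM3IR/CovariantFamily.lean`) implies every form below and is implied back by no known argument (label of
record: a genuine SUFFICIENT condition, converse NOT KNOWN — the printed analogue of a converse, Gibbsianness /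
constrained mixing of renormalisation-group images, exists for Ising-type systems only; never «the remaining gap»).

CONTENT (all PROVED, axioms standard, 0 compute; no new conjecture name).
* `massGap3Cofinal_of_irConjecture3InMean_printFree` — the in-mean composition of `InMean.lean` with `BalabanUV3 mk` and
  the carrier `mk` DELETED (F2 of the audit, in-mean currency; every `ρ`, every bounded link weight).
* `irConjecture3InMean_iff_massGap3Cofinal_of_forestWitness`, `irConjecture3InMean_iff_irConjecture3_of_forestWitness`,
  `t_IR_of_massGap3Cofinal_of_forestWitness`, `t_IR_iff_massGap3Cofinal_of_forestWitness`,
  `t_IRInMean_iff_massGap3Cofinal_of_forestWitness` — the class, abstractly in the forest witness `ForestWitness3 B r ρ`.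
* `irConjecture3InMean_iff_massGap3Cofinal_ballFR`, `t_IR_iff_massGap3Cofinal_ballFR` — on Y2's balls
  `ballOfRobustBallFR N ε₀ ε₁ rFR β⋆` via the tree theorem `forestWitness3_ballFR` (bi-invariant bounded link weights).
* `su2_irConjecture3InMean_iff_massGap3Cofinal`, `su2_t_IR_iff_massGap3Cofinal_balaban` — the §Y4 ball
  (`ClusterDomainFR (23/50) (23/100) rFR`, ceiling `1/16`, ds-2's hypothesis-free row) with `suFrobDist`; the second one
  on Bałaban's coupling set `balabanCouplings L (suGroupModel 2) eps0` GIVEN `BalabanUV3 mk`, i.e. the statement-of-record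
  hypothesis of `YM3IR/Statement.lean` is itself a certified dictionary for the target once print is supplied.
* `freeForms_of_irConjecture3Cov` — the PINNED (gauge-covariant, block-local) conjecture of theory-1 implies all four free-family
  forms at once (every carrier, every coarse rate); no converse is claimed or known (the forest witness is not covariant:
  `forestFamily_not_covariant_on_balabanCouplings`, `YM3IR/CovariantFamily.lean`).
WHY THIS IS NOVEL (cell rule (viii); bookkeeping sense only): it settles, in the kernel, which typed variants of a
Bałaban-style infrared hypothesis are reformulations of the lattice mass gap and isolates the single typing decision
(covariance of the block family) that makes it a sufficient condition — the honest-framing fact the paper must state.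

References: T. Bałaban, Commun. Math. Phys. 102 (1985) 255–275, Thms 1–2 [cite: Balaban1985UV3]; T. Bałaban,
Commun. Math. Phys. 99 (1985) 389, Thm 3.1 [cite: Balaban1985BackgroundPropagators]; H. Föllmer, LNM 1362 (1988) Ch. I
Remark (2.17) [cite: Follmer1988]; L. Bertini, E. Cirillo, E. Olivieri, J. Stat. Phys. 97 (1999), arXiv:cond-mat/9905434
(Gibbsianness of RG images under constrained strong mixing, Ising-type systems — the printed analogue of the converse
that is NOT available here); cell files
ym3ir/YM3-IR.md §B/§E, ym3ir/YM3-IR-theory2.md §9–§10, ym3ir/AUDIT-theory2-g4.md.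
-/

noncomputable section

open MeasureTheory ProbabilityTheory
open Literature.MathematicalPhysics.QuantumLattice Literature.MathematicalPhysics.QuantumFieldTheory
open Balaban1985CMP102 Balaban1985CMP102.Setting Balaban1985CMP102.Theorems
open Summit.QuantumFields.Balaban3D.Carriers (suGroupModel)

namespace Summit.Ventures.YMGap.YM3IR

open CarrierBridge

/-! ## 1. The class, abstractly in the forest witness -/

section Abstract

variable {G : Type} [MeasurableSpace G] {N : ℕ} [Group G] [TopologicalSpace G] [IsTopologicalGroup G]
  [CompactSpace G] [BorelSpace G]

/-- **(F2, in-mean currency) `ClusterDomainClustering ∧ IRConjecture3InMean ⟹ MassGap3Cofinal I` with `BalabanUV3 mk`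
and the carrier `mk` DELETED** — compare `massGap3Cofinal_of_irConjecture3InMean` (`YM3IR/InMean.lean`): identical
hypotheses and conclusion minus `hUV`/`mk`.  Every `ρ`, every link weight bounded above. [folklore] -/
theorem massGap3Cofinal_of_irConjecture3InMean_printFree {B : BallSpec G N} {r : G → G → ℝ}
    {ρ : G →* Matrix (Fin N) (Fin N) ℂ} {I : Set ℝ} {C_b κ m_c : ℝ} (hI : ¬ BddAbove I) (hC : 0 < C_b)
    (hκ : 0 < κ) (hm : 0 < m_c) (hr : ∃ D : ℝ, ∀ a b : G, r a b ≤ D) (hRB : ClusterDomainClustering B r m_c)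
    (hIR : IRConjecture3InMean B r ρ I C_b κ) : MassGap3Cofinal I r ρ := by
  obtain ⟨W, hE, hFD⟩ := hIR
  exact ⟨hI, min m_c κ / (3 * C_b), div_pos (lt_min hm hκ) (by positivity), C_b,
    latticeMassGap3Cofinal_of_inMean (le_min hm.le hκ.le) hr hRB hE hFD⟩

/-- **In-mean form ↔ target, given the forest witness** (and Y2's clustering on the ball at some rate `m_c > 0`, an
unbounded coupling set, a link weight bounded above): `(∃ C_b κ > 0, IRConjecture3InMean B r ρ I C_b κ) ↔
MassGap3Cofinal I r ρ`.  «→» is the print-free composition; «←» is the forest witness followed by a.s. ⟹ in-mean.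
Label (R196): a certified DICTIONARY, not a reduction. [folklore] -/
theorem irConjecture3InMean_iff_massGap3Cofinal_of_forestWitness {B : BallSpec G N} {r : G → G → ℝ}
    {ρ : G →* Matrix (Fin N) (Fin N) ℂ} {I : Set ℝ} {m_c : ℝ} (hF : ForestWitness3 B r ρ) (hI : ¬ BddAbove I)
    (hm : 0 < m_c) (hr : ∃ D : ℝ, ∀ a b : G, r a b ≤ D) (hRB : ClusterDomainClustering B r m_c) :
    (∃ C_b κ : ℝ, 0 < C_b ∧ 0 < κ ∧ IRConjecture3InMean B r ρ I C_b κ) ↔ MassGap3Cofinal I r ρ := by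
  refine ⟨fun ⟨_, _, hC, hκ, h⟩ => massGap3Cofinal_of_irConjecture3InMean_printFree hI hC hκ hm hr hRB h, fun h => ?_⟩
  obtain ⟨C_b, κ, hC, hκ, h3⟩ := hF I h
  exact ⟨C_b, κ, hC, hκ, irConjecture3InMean_of_irConjecture3 h3⟩

/-- **The two free-family currencies are equivalent** (existential bookkeeping constants; forest witness, Y2 clustering,
unbounded `I`, bounded link weight): `(∃ C_b κ > 0, IRConjecture3InMean …) ↔ (∃ C_b κ > 0, IRConjecture3 …)`.  The
in-mean clauses are weaker CLAUSE-WISE (`irConjecture3InMean_of_irConjecture3` is pointwise in `W`); as typed over a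
free measurable block family the two conjectures nevertheless have the same truth value. [folklore] -/
theorem irConjecture3InMean_iff_irConjecture3_of_forestWitness {B : BallSpec G N} {r : G → G → ℝ}
    {ρ : G →* Matrix (Fin N) (Fin N) ℂ} {I : Set ℝ} {m_c : ℝ} (hF : ForestWitness3 B r ρ) (hI : ¬ BddAbove I)
    (hm : 0 < m_c) (hr : ∃ D : ℝ, ∀ a b : G, r a b ≤ D) (hRB : ClusterDomainClustering B r m_c) :
    (∃ C_b κ : ℝ, 0 < C_b ∧ 0 < κ ∧ IRConjecture3InMean B r ρ I C_b κ) ↔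
      (∃ C_b κ : ℝ, 0 < C_b ∧ 0 < κ ∧ IRConjecture3 B r ρ I C_b κ) :=
  (irConjecture3InMean_iff_massGap3Cofinal_of_forestWitness hF hI hm hr hRB).trans
    (irConjecture3_iff_massGap3Cofinal_of_forestWitness hF hI hm hr hRB).symm

/-- **Target ⟹ the statement-of-record hypothesis `T_IR`, for EVERY carrier `mk` and every coarse rate `m_c`, given the
forest witness** — no print needed in this direction (clause (a) holds outright for the forest family, the support
conjunct `DecayTransfer` is the hypothesis-free tree theorem `decayTransfer_free`). [folklore] -/
theorem t_IR_of_massGap3Cofinal_of_forestWitness {L : ℕ} (mk : Construction L) {B : BallSpec G N} {r : G → G → ℝ}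
    {ρ : G →* Matrix (Fin N) (Fin N) ℂ} {I : Set ℝ} (m_c : ℝ) (hF : ForestWitness3 B r ρ)
    (h : MassGap3Cofinal I r ρ) : ∃ C_b κ : ℝ, 0 < C_b ∧ 0 < κ ∧ T_IR mk B r ρ I C_b κ m_c := by
  obtain ⟨C_b, κ, hC, hκ, h3⟩ := hF I h
  exact ⟨C_b, κ, hC, hκ, DecayTransferProof.t_IR_of_irConjecture3' mk h3⟩

/-- **GIVEN PRINT, the statement-of-record hypothesis is a certified dictionary too:** `BalabanUV3 mk ⊢
(∃ C_b κ > 0, T_IR mk B r ρ I C_b κ m_c) ↔ MassGap3Cofinal I r ρ` (forest witness, Y2 clustering AT THE SAME RATE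
`m_c > 0`, unbounded `I`, bounded link weight).  «→» is `massGap3Cofinal_of` (`YM3IR/Statement.lean`) and is the only
place print enters — it un-guards clause (a) `Crossover3 := BalabanUV3 mk → EntersClusterDomain …`; without `hUV` the
«→» fails for trivial reasons (a false guard makes `T_IR` cheap), which is why the iff is stated under print. [folklore] -/
theorem t_IR_iff_massGap3Cofinal_of_forestWitness {L : ℕ} {mk : Construction L} {B : BallSpec G N} {r : G → G → ℝ}
    {ρ : G →* Matrix (Fin N) (Fin N) ℂ} {I : Set ℝ} {m_c : ℝ} (hF : ForestWitness3 B r ρ) (hI : ¬ BddAbove I)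
    (hm : 0 < m_c) (hr : ∃ D : ℝ, ∀ a b : G, r a b ≤ D) (hUV : BalabanUV3 mk)
    (hRB : ClusterDomainClustering B r m_c) :
    (∃ C_b κ : ℝ, 0 < C_b ∧ 0 < κ ∧ T_IR mk B r ρ I C_b κ m_c) ↔ MassGap3Cofinal I r ρ :=
  ⟨fun ⟨_, _, hC, hκ, h⟩ => massGap3Cofinal_of hI hC hκ hm hr hUV hRB h,
    t_IR_of_massGap3Cofinal_of_forestWitness mk m_c hF⟩

/-- **The in-mean statement-of-record hypothesis `T_IRInMean`, given print:** `BalabanUV3 mk ⊢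
(∃ C_b κ > 0, T_IRInMean mk B r ρ I C_b κ) ↔ MassGap3Cofinal I r ρ`. [folklore] -/
theorem t_IRInMean_iff_massGap3Cofinal_of_forestWitness {L : ℕ} {mk : Construction L} {B : BallSpec G N}
    {r : G → G → ℝ} {ρ : G →* Matrix (Fin N) (Fin N) ℂ} {I : Set ℝ} {m_c : ℝ} (hF : ForestWitness3 B r ρ)
    (hI : ¬ BddAbove I) (hm : 0 < m_c) (hr : ∃ D : ℝ, ∀ a b : G, r a b ≤ D) (hUV : BalabanUV3 mk)
    (hRB : ClusterDomainClustering B r m_c) :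
    (∃ C_b κ : ℝ, 0 < C_b ∧ 0 < κ ∧ T_IRInMean mk B r ρ I C_b κ) ↔ MassGap3Cofinal I r ρ := by
  refine ⟨fun ⟨_, _, hC, hκ, h⟩ => massGap3Cofinal_of_inMean hI hC hκ hm hr hUV hRB h, fun h => ?_⟩
  obtain ⟨C_b, κ, hC, hκ, h3⟩ := hF I h
  exact ⟨C_b, κ, hC, hκ, t_IRInMean_of_conjecture mk (irConjecture3InMean_of_irConjecture3 h3)⟩

end Abstract

/-! ## 2. On Y2's balls `ballOfRobustBallFR N ε₀ ε₁ rFR β⋆` (the forest witness is the tree theorem `forestWitness3_ballFR`) -/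

section BallFR

variable {N : ℕ} {r : RobustBall.SUN N → RobustBall.SUN N → ℝ}

/-- **In-mean form ↔ target on every Y2 ball `ballOfRobustBallFR N ε₀ ε₁ rFR β⋆`** (radii `≥ 0`; fundamental Wilson
action; bounded bi-invariant symmetric link weight with `r a a = 0` and the triangle inequality; Y2's clustering on the
ball at a rate `m_c > 0`; unbounded coupling set). [folklore] -/
theorem irConjecture3InMean_iff_massGap3Cofinal_ballFR {ε₀ ε₁ βstar : ℝ} (h₀ : 0 ≤ ε₀) (h₁ : 0 ≤ ε₁)
    (hβ : 0 ≤ βstar) (rFR : ℕ) {I : Set ℝ} {m_c : ℝ} (hI : ¬ BddAbove I) (hm : 0 < m_c)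
    (hmulL : ∀ g a a' : RobustBall.SUN N, r (g * a) (g * a') = r a a')
    (hmulR : ∀ g a a' : RobustBall.SUN N, r (a * g) (a' * g) = r a a')
    (hsymm : ∀ a a' : RobustBall.SUN N, r a a' = r a' a) (hself : ∀ a : RobustBall.SUN N, r a a = 0)
    (htri : ∀ a a' a'' : RobustBall.SUN N, r a a'' ≤ r a a' + r a' a'')
    (hr : ∃ D : ℝ, ∀ a a' : RobustBall.SUN N, r a a' ≤ D)
    (hRB : ClusterDomainClustering (ballOfRobustBallFR N ε₀ ε₁ rFR βstar) r m_c) :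
    (∃ C_b κ : ℝ, 0 < C_b ∧ 0 < κ ∧
        IRConjecture3InMean (ballOfRobustBallFR N ε₀ ε₁ rFR βstar) r (fundamentalRep (Fin N)) I C_b κ)
      ↔ MassGap3Cofinal I r (fundamentalRep (Fin N)) :=
  irConjecture3InMean_iff_massGap3Cofinal_of_forestWitness
    (forestWitness3_ballFR h₀ h₁ hβ rFR hmulL hmulR hsymm hself htri hr) hI hm hr hRB

/-- **`T_IR` ↔ target on every Y2 ball, GIVEN PRINT** (hypotheses as above, plus `BalabanUV3 mk`; coarse rate of
`T_IR` = Y2's rate `m_c`). [folklore] -/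
theorem t_IR_iff_massGap3Cofinal_ballFR {L : ℕ} {mk : Construction L} {ε₀ ε₁ βstar : ℝ} (h₀ : 0 ≤ ε₀)
    (h₁ : 0 ≤ ε₁) (hβ : 0 ≤ βstar) (rFR : ℕ) {I : Set ℝ} {m_c : ℝ} (hI : ¬ BddAbove I) (hm : 0 < m_c)
    (hmulL : ∀ g a a' : RobustBall.SUN N, r (g * a) (g * a') = r a a')
    (hmulR : ∀ g a a' : RobustBall.SUN N, r (a * g) (a' * g) = r a a')
    (hsymm : ∀ a a' : RobustBall.SUN N, r a a' = r a' a) (hself : ∀ a : RobustBall.SUN N, r a a = 0)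
    (htri : ∀ a a' a'' : RobustBall.SUN N, r a a'' ≤ r a a' + r a' a'')
    (hr : ∃ D : ℝ, ∀ a a' : RobustBall.SUN N, r a a' ≤ D) (hUV : BalabanUV3 mk)
    (hRB : ClusterDomainClustering (ballOfRobustBallFR N ε₀ ε₁ rFR βstar) r m_c) :
    (∃ C_b κ : ℝ, 0 < C_b ∧ 0 < κ ∧
        T_IR mk (ballOfRobustBallFR N ε₀ ε₁ rFR βstar) r (fundamentalRep (Fin N)) I C_b κ m_c)
      ↔ MassGap3Cofinal I r (fundamentalRep (Fin N)) :=
  t_IR_iff_massGap3Cofinal_of_forestWitness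
    (forestWitness3_ballFR h₀ h₁ hβ rFR hmulL hmulR hsymm hself htri hr) hI hm hr hUV hRB

end BallFR

/-! ## 3. The §Y4 ball: `SU(2)`, `ClusterDomainFR (23/50) (23/100) rFR`, ceiling `1/16`, link weight `suFrobDist` -/

section SU2

/-- **In-mean twin of `su2_irConjecture3_iff_massGap3Cofinal` (KERNEL)**: on Y2's certified `SU(2)` row (ds-2's
hypothesis-free `RobustBall.su2_clusterDomainClustering_dim3_oneEighth`), for EVERY unbounded coupling set `I` — in
particular Bałaban's —: `(∃ C_b κ > 0, IRConjecture3InMean …) ↔ MassGap3Cofinal I suFrobDist ρ_fund`.  The «weaker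
quotable form» of the one conjecture is, as typed over a free block family, EQUIVALENT to the conclusion (label R196:
dictionary, not reduction). [folklore] -/
theorem su2_irConjecture3InMean_iff_massGap3Cofinal (rFR : ℕ) {I : Set ℝ} (hI : ¬ BddAbove I) :
    (∃ C_b κ : ℝ, 0 < C_b ∧ 0 < κ ∧
        IRConjecture3InMean (ballOfRobustBallFR 2 (23 / 50) (23 / 100) rFR (1 / 16)) suFrobDist
          (fundamentalRep (Fin 2)) I C_b κ)
      ↔ MassGap3Cofinal I suFrobDist (fundamentalRep (Fin 2) : RobustBall.SUN 2 →* Matrix (Fin 2) (Fin 2) ℂ) :=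
  irConjecture3InMean_iff_massGap3Cofinal_ballFR (by norm_num) (by norm_num) (by norm_num) rFR hI
    (su2_dim3_oneEighth_rate_pos' rFR) suFrobDist_mul_left suFrobDist_mul_right suFrobDist_comm suFrobDist_self
    suFrobDist_triangle (suFrobDist_bddAbove 2) (RobustBall.su2_clusterDomainClustering_dim3_oneEighth rFR)

/-- **The statement-of-record hypothesis on the §Y4 sentence's own data is a certified dictionary GIVEN PRINT (KERNEL):**
for `SU(2)`, Bałaban's coupling set `balabanCouplings L (suGroupModel 2) eps0` (inhabited family), the §Y4 ball and
ds-2's row rate `m_row = −log ρ⋆ / (rFR ⊔ 1)`: `BalabanUV3 mk ⊢ (∃ C_b κ > 0, T_IR mk B suFrobDist ρ_fund I_Bałaban C_b κ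
m_row) ↔ MassGap3Cofinal I_Bałaban suFrobDist ρ_fund`.  «→» = the composition of record `massGap3Cofinal_of`; «←» = the
forest witness.  This is what «typed INTERFACE, not a reduction» means for `YM3IR/Statement.lean` itself.
[cite: Balaban1985UV3, Thm 1 p.257; Thm 2 p.272] -/
theorem su2_t_IR_iff_massGap3Cofinal_balaban {L : ℕ} {mk : Construction L} {eps0 : ℝ → ℝ}
    (hfam : Nonempty (Family L eps0)) (rFR : ℕ) (hUV : BalabanUV3 mk) :
    (∃ C_b κ : ℝ, 0 < C_b ∧ 0 < κ ∧
        T_IR mk (ballOfRobustBallFR 2 (23 / 50) (23 / 100) rFR (1 / 16)) suFrobDist (fundamentalRep (Fin 2))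
          (balabanCouplings L (suGroupModel 2) eps0) C_b κ
          (-Real.log (RobustBall.rhoFR 2 (3 / 8) (23 / 50) (23 / 100)) / ((max rFR 1 : ℕ) : ℝ)))
      ↔ MassGap3Cofinal (balabanCouplings L (suGroupModel 2) eps0) suFrobDist
          (fundamentalRep (Fin 2) : RobustBall.SUN 2 →* Matrix (Fin 2) (Fin 2) ℂ) :=
  t_IR_iff_massGap3Cofinal_ballFR (by norm_num) (by norm_num) (by norm_num) rFR
    (not_bddAbove_balabanCouplings (suGroupModel 2) hfam) (su2_dim3_oneEighth_rate_pos' rFR) suFrobDist_mul_left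
    suFrobDist_mul_right suFrobDist_comm suFrobDist_self suFrobDist_triangle (suFrobDist_bddAbove 2) hUV
    (RobustBall.su2_clusterDomainClustering_dim3_oneEighth rFR)

end SU2

/-! ## 4. The one typing decision that changes logical status: pinning the family -/

section Pinned

variable {G : Type} [MeasurableSpace G] {N : ℕ} [Group G] [TopologicalSpace G] [IsTopologicalGroup G]
  [CompactSpace G] [BorelSpace G]

/-- **PINNED ⟹ every free form (PROVED bookkeeping; the converse is NOT claimed and not known).**  theory-1's
`IRConjecture3Cov B r ρ I C_b κ` (a gauge-covariant, block-local family with clauses (a)+(b)) implies, with the SAME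
family and constants, the a.s. form `IRConjecture3`, the in-mean form `IRConjecture3InMean`, and — for every carrier `mk`
and every coarse rate `m_c` — the statement-of-record hypotheses `T_IR` and `T_IRInMean`.  Together with §§1–3: above the
equivalence class {free forms} ≡ `MassGap3Cofinal` sits exactly one strictly-typed member, the pinned conjecture; whether
it is strictly STRONGER is open (printed obstruction to a cheap converse: unconstrained strong mixing does not imply
constrained strong mixing in general — Bertini–Cirillo–Olivieri 1999, spin systems). [folklore] -/
theorem freeForms_of_irConjecture3Cov {L : ℕ} (mk : Construction L) (m_c : ℝ) {B : BallSpec G N} {r : G → G → ℝ}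
    {ρ : G →* Matrix (Fin N) (Fin N) ℂ} {I : Set ℝ} {C_b κ : ℝ} (h : IRConjecture3Cov B r ρ I C_b κ) :
    IRConjecture3 B r ρ I C_b κ ∧ IRConjecture3InMean B r ρ I C_b κ ∧ T_IR mk B r ρ I C_b κ m_c ∧
      T_IRInMean mk B r ρ I C_b κ :=
  have h3 := irConjecture3_of_cov h
  ⟨h3, irConjecture3InMean_of_irConjecture3 h3, DecayTransferProof.t_IR_of_irConjecture3' mk h3,
    t_IRInMean_of_conjecture mk (irConjecture3InMean_of_irConjecture3 h3)⟩

end Pinned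

end Summit.Ventures.YMGap.YM3IR

end
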